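import Mathlib
import Literature.MathematicalPhysics.QuantumFieldTheory.Balaban1983to89.B6Cor28
import Literature.MathematicalPhysics.QuantumFieldTheory.Balaban1983to89.B6Lemma21Repaired

/-!
# `Balaban1983to89.B6Ineq288Edge` — p. 238: the FIRST inequality of (2.88) — the three kernel bounds of ∂P∂* READ OFF
the verbatim Propositions 2.2 and 2.3, and the DAG edge Prop. 2.2 ∧ Prop. 2.3 ∧ Lemma 2.1 → (2.88)

B6 = T. Bałaban, *Propagators and renormalization transformations for lattice gauge theories. II*, Commun. Math. Phys.
**96**, 223–250 (1984) [Balaban1984PropagatorsII].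

FRAMING (verbatim cell line — this module is co-authored by the `lit-balaban` cell since v1.1 p300684, seat r03 gen 8;
HOME `run/shared/lean/pub/lit-balaban/`, SKELETON row B6.Eq2.88; v1.2, seat r03 gen 9, adds this paragraph only — every
declaration below is byte-identical to v1.1, referee item N-g28-1 of `lit-balaban` ref-3 gen 28):
statement-level skeleton of published theorems with citation tags; proofs where landed; nothing here is a claim about the Yang–Mills mass gap

CITATION HEADER (lean-in-tree rule 2026-08-18).  Cell `pub-balaban`, unit `b2b-balaban-b06-g13` (paper sub-cell B06,
gen 13 — the owner lineage of `…B6`, `…B6RandomWalk`, `…B6Prop23Chain`, `…B6Prop23Assembled`, `…B6Prop23Printed`,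
`…B6Prop23MajorantInput`).  Imports: Mathlib + tree `…B6Cor28` (unit b2b-balaban-pv01, v2 p176652: the typed (2.88)
`Ineq288`, the kernel composition `ineq288_kernel` with the three kernel bounds as HYPOTHESES, the scale transfers
`transfer_of_260`, `ineq288_printed_of_lemma21`) + tree `…B6Lemma21Repaired` (the generic-constant displays
`Ineq261With` ∕ `Ineq263With` of (2.61) ∕ (2.63)); nothing landed is modified.  Source: doi:10.1007/bf01240221, held
`paper:balaban1984-cmp96-propagators-rt-ii`; journal page = PDF page + 222; the quotations below were read from the page
renders `b2b-balaban-ref1/pages/1984-cmp96-propagators-rt-II/1984-cmp96-propagators-rt-II-p012-x2.png` (p. 234) and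
`…-p016-x2.png` (p. 238) AS IMAGES this session.  Cell rows GAPS C-b06g13-2 (kernel twin of the located item GAPS
G-pv01-4 (iii), unit b2b-balaban-pv01), DIVERGENCE D-b06.32; journal claim INEQ288-EDGE.

THE PRINTED TEXT.  p. 234 [PDF 12], Proposition 2.2, verbatim: *"If we have (2.1), (2.2) and M is sufficiently large,
then the operator G′ = Δ′_a^{−1} (a = 1) satisfies the inequalities |(G′λ)(x)|, |(∇G′λ)(x)|, |(G′∇*λ)(x)|, ‖ζ∇G′λ‖_α,
‖ζG′∇*λ‖_α, |(ΔG′λ)(x)| ≤ O(1)[(L^jη)², L^jη, L^jη, (L^jη)^{1−α}(‖ζ‖_α + |ζ|), (L^jη)^{1−α}(‖ζ‖_α + |ζ|), 1]·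
e^{−½δ₀d(y,y′)}|λ|, x ∈ B^j(y) or supp ζ ⊂ B^j(y), y ∈ Λ_j, supp λ ⊂ B^{j′}(y′), y′ ∈ Λ_{j′}. (2.67)"*.  p. 238
[PDF 16], verbatim: *"and it satisfies the estimate |(Q′G′²Q′*)⁻¹(y, y′)| ≤ O(1)(L^jη)^{−4}(L^{j′}η)^{−d}e^{−½δ₁d(y,y′)}
y, y′ ∈ 𝔅, y ∈ Λ_j, y′ ∈ Λ_{j′}. (2.87) Finally let us consider the kernel of the operator ∂P∂* appearing in ∂R∂*,
R = I − P given by (2.18). We have from Lemma 2.1, Proposition 2.2 and (2.87), |(∂P∂*)_{μν}(x, x′)| =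
|(∂_μG′Q′*(Q′G′²Q′*)⁻¹Q′G′∂*_ν)(x, x′)| ≤ O(1) Σ_{y₁,y₂∈𝔅} L^jη e^{−½δ₀d(y,y₁)}(L^{j₁}η)^{−4}e^{−½δ₁d(y₁,y₂)}(L^{j₂}η)^{−d}
· e^{−½δ₀d(y₂,y′)}L^{j′}η ≤ O(1)(L^jη)^{−2}(L^{j′}η)^{−d}e^{−δ₂d(y,y′)}, (2.88) where x ∈ B^j(y), x′ ∈ B^{j′}(y′),
y ∈ Λ_j, y′ ∈ Λ_{j′}, and δ₂ is determined by δ₀, δ₁. The choice of factors is again arbitrary and may be changed into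
any other admissible choice."*

WHAT THE TREE HAD.  `…B6Cor28` (pv01, GAPS G-pv01-4, DIVERGENCE D-pv01.4) kernel-checks the SECOND inequality of
(2.88): three abstract site kernels K₁, K₂, K₃ on 𝔅 with the printed majorants AS HYPOTHESES (`hK₁`: C₁(L^jη)e^{−ad},
`hK₂`: C₂(L^{j₁}η)^{−4}(L^{j₂}η)^{−d}e^{−bd}, `hK₃`: C₃(L^{j′}η)e^{−cd}) compose, by the scale transfers from (2.60)
and the three-point convolution (2.63), to the right-hand side `Ineq288` with δ₂ = (1 − α)δ and O(1) explicit.  Its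
G-pv01-4 (iii), verbatim from the cell record: *"The FIRST inequality of (2.88) is the reader's kernel identification:
Prop. 2.2 (2.67) entries ∇G′ (factor L^jη) and G′∇* applied with λ = Q′*δ_{y₁} (supp λ ⊂ B^{j₁}(y₁), |λ| = O(1) by
(2.3)–(2.4) p. 224) and (2.87); … this identification is not printed and stays a HYPOTHESIS (three kernel bounds) in
the tree."*  THIS MODULE discharges those three hypotheses from the VERBATIM typed statements `B6.Prop22Printed`
(Proposition 2.2) and `B6.Prop23Printed` (Proposition 2.3) of `…B6`, modulo a located READING of the abstract
test-function fields of `B6.Geometry`, and composes the edge.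

THE TYPING (that of `…B6` ∕ `…B6Cor28`; the one new item is the reading).  𝔅 = `g.Site`, j = `g.scale`, d(·,·) =
`g.dist`, L^jη = `g.len` of the abstract carrier `g : B6.Geometry`; the entries of (2.67) are the numbers
`(Gp i).e n λ y` (n = 0, 1, 2, 3 ↔ G′, ∇G′, G′∇*, ΔG′; prefactor table `B6.pref4` = [(L^jη)², L^jη, L^jη, 1]) on
abstract λ : `g.Loc` with `g.suppIn λ y′` = *"supp λ ⊂ B^{j′}(y′)"* and `g.supNorm λ` = *"|λ|"*; (2.87) is the bound on
`(Cinv i).ker`.  THE READING (located; the print's *"from … Proposition 2.2"*, G-pv01-4 (iii)): the outer kernels of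
(2.88) are site kernels K₁(y, y₁) (for ∂_μG′Q′* at x ∈ B^j(y)) and K₃(y₂, y′) (for Q′G′∂*_ν at x′ ∈ B^{j′}(y′)); there
are families of test functions λ₁(y₁), λ₃(y₂) : `g.Loc` (*"λ = Q′*δ_{y₁}"*) with supp λ₁(y₁) ⊂ B^{j₁}(y₁) (`hsupp`),
|λ₁(y₁)| ≤ c_Q (`hnorm`, the O(1) of the averaging kernel), and the kernels are DOMINATED by entries of (2.67) with the
prefactor L^jη: |K₁(y, y₁)| ≤ e_{n₁}(λ₁(y₁), y) (`hval₁`, n₁ ∈ {1, 2}: *"∂_μG′Q′*"* read as ∇G′ applied to λ = Q′*δ_{y₁}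
and evaluated at x ∈ B^j(y)) and |K₃(y₂, y′)| ≤ e_{n₃}(λ₃(y₂), y′) (`hval₃`: the printed factor e^{−½δ₀d(y₂,y′)}L^{j′}η
carries the prefactor of the x′-end, i.e. Q′G′∂*_ν is read from x′ ∈ B^{j′}(y′) with the test function at y₂ — one of
the *"admissible choices"* of the closing sentence; it is the shape of `B6Cor28`'s `hK₃`), the pseudo-distance being
symmetric (`hsymm` — the definition (2.46) p. 231 by contours is symmetric; `B6Geometry.dist_comm_of_realizes` for
realised geometries).  NOTHING of this reading is asserted: it enters as hypotheses, exactly as the reading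
(ιL, hloc, hval) of entry 0 in `…B6Prop23MajorantInput`.

WHAT THIS MODULE PROVES (kernel-checked; no `sorry`, no axiom beyond Lean's three):
1. §1 `pref4_one`, `pref4_two` (the table at entries 1, 2 is L^jη); **`kerBound_of_entry`** — an entry of (2.67) with
   prefactor L^jη, read through (hsupp, hnorm, hval), IS the kernel bound |K(y, y₁)| ≤ C·c_Q·(L^jη)·e^{−r d(y,y₁)}
   (the shape of `B6Cor28.ineq288_kernel`'s `hK₁`); `kerBound_of_entry_adj` — the same read from the far end, with the
   symmetry of d, gives the shape of `hK₃`.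
2. §2 **`kernelBounds_of_printed`** — `B6.Prop22Printed geo Gp` ∧ `B6.Prop23Printed d geo Cinv` ⟹ with THEIR witnesses
   (max(M₁, M₁′) =: M₂, δ₀, δ₁, the two O(1) =: C′, C″): for every situation i with M_i ≥ M₂ (and 1 ≤ L, 0 < η for the sign
   of L^jη) and every pair of outer kernels read as above, the THREE HYPOTHESES hK₁ (C₁ = C′c_Q, a = ½δ₀), hK₂ (K₂ =
   (Q′G′²Q′*)⁻¹ = `(Cinv i).ker`, C₂ = C″, b = ½δ₁ — this one is (2.87) verbatim), hK₃ (C₃ = C′c_Q, c = ½δ₀) of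
   `B6Cor28.ineq288_kernel` HOLD — the printed first inequality of (2.88), with its rates ½δ₀, ½δ₁, ½δ₀.
3. §3 `conv3_of_ineq263With` ((2.63) with a generic constant c_L, n = 3, is `B6Cor28.Conv3` with C_c = c_L³);
   `ineq288_generic` — `B6Cor28.ineq288_of_lemma21` re-run with the GENERIC-constant (2.60) ∕ (2.61) of one geometry
   (`B6RandomWalk.Ineq260 g δ α`, `B6Lemma21Repaired.Ineq261With c_L g δ α`) in place of `B6.Lemma21Printed` (whose
   printed c₁(α) is refuted as typed for d ≥ 3, GAPS G-A11-1): O(1) = C₁C₂C₃·L⁴·L^d·L·c_L³, δ₂ = (1 − α)δ;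
   **`ineq288_of_printed`** — THE EDGE: Prop. 2.2 ∧ Prop. 2.3 (verbatim typings) ∧ the reading ∧ (2.54) ∧ (2.60), (2.61)
   at a rate δ with (1 + 2α)δ ≤ ½δ₀, (1 + α)δ ≤ ½δ₁ ∧ the largeness L⁴, L^d, L ≤ e^{αδRM} ⟹ `B6Cor28.Ineq288` for the
   kernels (K₁, (Q′G′²Q′*)⁻¹, K₃) with δ₂ = (1 − α)δ and O(1) = (C′c_Q)·C″·(C′c_Q)·L⁴·L^d·L·c_L³ — *"δ₂ is determined
   by δ₀, δ₁"* made explicit; `ineq288_of_printed_lemma21` — the same with the tree's VERBATIM `B6.Lemma21Printed d δ geo`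
   (through pv01's `ineq288_printed_of_lemma21`, c_L = c₁(α)): literally *"from Lemma 2.1, Proposition 2.2 and (2.87)"*
   as typed Props — HONEST SCOPE: that antecedent is refuted as typed on geometries with d ≥ 3 (the generic form is the
   substantive one); (v1.1, seat r03 gen 8) **`ineq288_of_printed_lemma21Repaired`** — the same sentence with the
   REPAIRED Lemma 2.1′ of the tree `B6Lemma21Repaired.Lemma21Repaired d δ geo` as antecedent (c_L = c₁′ =
   `B6Lemma21Arith.c1Repaired d δ α`, proved unconditionally on the multi-level tower family), one line from
   `ineq288_of_printed`.
4. §4 `unitGeo`, `unitGp`, `unitKer` (+ `unitGeo_len`, `unitGeo_dist`), `prop22Printed_unit`, `prop23Printed_unit`,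
   **`unitGeo_nonvacuous`** — CONSISTENCY of the hypothesis
   package of `ineq288_of_printed`: on the one-site family (L = η = R = 1, M free, d ≡ 0, `Loc` = the functions, e_n(λ, y)
   = |λ(·)|, all kernels ≡ 1, c_Q = c_L = 1, δ = 0, α = ½) both printed Props are INHABITED and the edge theorem FIRES
   (every hypothesis discharged in the proof term), yielding |Σ_{y₁,y₂} 1·1·1| ≤ C on that model.
WHAT IT DOES NOT PROVE: Proposition 2.2, Proposition 2.3, Lemma 2.1 (they enter as the typed hypotheses they are in
`…B6`; the lineage's kernel-checked chains live in `…B6Prop23Chain` ∕ `…B6Prop23Assembled` ∕ `…B6Prop23Printed`); that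
the kernels of ∂_μG′Q′* and Q′G′∂*_ν ARE dominated by the (2.67) quantities with λ = Q′*δ_{y} (the reading — located,
G-pv01-4 (iii); it needs the boundedness of the averaging kernel Q′* and, for K₃, the symmetry of G′); the operator
identity (∂P∂*)_{μν} = ∂_μG′Q′*(Q′G′²Q′*)⁻¹Q′G′∂*_ν (P = I − R, R *"given by (2.18)"*; not typed here); the pairing weights (L^{j₁}η)^d(L^{j₂}η)^d of (2.69) in
the composition (the print's Σ_{y₁,y₂∈𝔅} in (2.88) is plain and `B6Cor28.comp3` follows it, D-pv01.4 (a)); the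
second inequality of (2.88) (pv01's `ineq288_kernel`, used by name).  Value = certified DAG edge PROP22 ∧ PROP23 ∧
LEMMA21 → (2.88) of the paper with the reader's identification made an explicit located hypothesis, NOT summit progress.
-/

namespace Literature.MathematicalPhysics.QuantumFieldTheory.Balaban1983to89.B6Ineq288Edge

open Finset
open B6RandomWalk (Triangle254 Ineq260)
open B6Lemma21Repaired (Ineq261With Ineq263With ineq263With_of_261With)
open B6Cor28 (TransferR TransferL Conv3 comp3 Ineq288 ineq288_kernel transfer_of_260 len_eq_rpow len_pos
  ineq288_printed_of_lemma21)

/-! ## §1  Entries of (2.67) with prefactor L^jη, read as site-kernel bounds -/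

section Dictionary

variable {g : B6.Geometry}

/-- The prefactor table of (2.67) at entry 1 (∇G′) is L^jη. [cite: Balaban1984PropagatorsII, (2.67) p.234] -/
theorem pref4_one (t : ℝ) : B6.pref4 t 1 = t := by
  simp [B6.pref4]

/-- The prefactor table of (2.67) at entry 2 (G′∇*) is L^jη. [cite: Balaban1984PropagatorsII, (2.67) p.234] -/
theorem pref4_two (t : ℝ) : B6.pref4 t 2 = t := by
  simp [B6.pref4]

/-- **AN ENTRY OF (2.67) WITH PREFACTOR L^jη READ AS A SITE-KERNEL BOUND.**  p. 234 (2.67): *"|(∇G′λ)(x)|, |(G′∇*λ)(x)|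
≤ O(1) L^jη e^{−½δ₀d(y,y′)}|λ|, x ∈ B^j(y), y ∈ Λ_j, supp λ ⊂ B^{j′}(y′), y′ ∈ Λ_{j′}"*; p. 238: *"We have from …
Proposition 2.2 …"* the factor *"L^jη e^{−½δ₀d(y,y₁)}"* of (2.88).  In the typing of `…B6` the entry is the number
`E λ y` (E = `(Gp i).e n`, n = 1 or 2: `hn`); under the located READING — a family of test functions λ(y₁) : `g.Loc`
(*"λ = Q′*δ_{y₁}"*) with supp λ(y₁) ⊂ B^{j₁}(y₁) (`hsupp`) and |λ(y₁)| ≤ c_Q (`hnorm`), the kernel dominated by the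
entry, |K(y, y₁)| ≤ E(λ(y₁), y) (`hval`) — the printed clause with constant C ≥ 0 and any rate r (`h267`, the shape
of the n-th clause of `B6.Prop22Printed`) gives |K(y, y₁)| ≤ C·c_Q·(L^jη)¹·e^{−r d(y,y₁)}: the hypothesis `hK₁` of
`B6Cor28.ineq288_kernel`.  (L^jη ≥ 0 is needed for the monotone step in |λ| and is supplied by 1 ≤ L, 0 < η
downstream.) [cite: Balaban1984PropagatorsII, Prop. 2.2 (2.67) p.234; (2.88) p.238] -/
theorem kerBound_of_entry (E : g.Loc → g.Site → ℝ) (K : g.Site → g.Site → ℝ) (lam : g.Site → g.Loc)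
    (n : Fin 4) (hn : ∀ t, B6.pref4 t n = t) {C r cQ : ℝ} (hC : 0 ≤ C)
    (hsupp : ∀ y₁, g.suppIn (lam y₁) y₁) (hnorm : ∀ y₁, g.supNorm (lam y₁) ≤ cQ)
    (hval : ∀ y y₁, |K y y₁| ≤ E (lam y₁) y)
    (h267 : ∀ (μ : g.Loc) (y y' : g.Site), g.suppIn μ y' →
      E μ y ≤ C * B6.pref4 (g.len y) n * Real.exp (-(r * g.dist y y')) * g.supNorm μ)
    (hlen : ∀ y, 0 ≤ g.len y) :
    ∀ y y₁, |K y y₁| ≤ C * cQ * g.len y ^ (1 : ℝ) * Real.exp (-(r * g.dist y y₁)) := by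
  intro y y₁
  have h2 := h267 (lam y₁) y y₁ (hsupp y₁)
  rw [hn] at h2
  have hfac : 0 ≤ C * g.len y * Real.exp (-(r * g.dist y y₁)) :=
    mul_nonneg (mul_nonneg hC (hlen y)) (Real.exp_nonneg _)
  rw [Real.rpow_one]
  calc |K y y₁| ≤ E (lam y₁) y := hval y y₁
    _ ≤ C * g.len y * Real.exp (-(r * g.dist y y₁)) * g.supNorm (lam y₁) := h2
    _ ≤ C * g.len y * Real.exp (-(r * g.dist y y₁)) * cQ := mul_le_mul_of_nonneg_left (hnorm y₁) hfac
    _ = C * cQ * g.len y * Real.exp (-(r * g.dist y y₁)) := by ring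

/-- **THE SAME ENTRY READ FROM THE FAR END** (the third factor of (2.88), *"e^{−½δ₀d(y₂,y′)}L^{j′}η"*: the operator
Q′G′∂*_ν at x′ ∈ B^{j′}(y′) with the test function at y₂ — the printed prefactor is that of the x′-end, *"The choice
of factors is again arbitrary and may be changed into any other admissible choice"*): with |K₃(y₂, y′)| ≤ E(λ(y₂), y′)
(`hval`) and the symmetry of the pseudo-distance (`hsymm`; (2.46) p. 231, `B6Geometry.dist_comm_of_realizes` for
realised geometries) one gets |K₃(y₂, y′)| ≤ C·c_Q·(L^{j′}η)¹·
e^{−r d(y₂,y′)}: the hypothesis `hK₃` of `B6Cor28.ineq288_kernel`. [cite: Balaban1984PropagatorsII, Prop. 2.2 (2.67) p.234; (2.88) p.238] -/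
theorem kerBound_of_entry_adj (E : g.Loc → g.Site → ℝ) (K₃ : g.Site → g.Site → ℝ) (lam : g.Site → g.Loc)
    (n : Fin 4) (hn : ∀ t, B6.pref4 t n = t) {C r cQ : ℝ} (hC : 0 ≤ C)
    (hsupp : ∀ y₂, g.suppIn (lam y₂) y₂) (hnorm : ∀ y₂, g.supNorm (lam y₂) ≤ cQ)
    (hval : ∀ y₂ y', |K₃ y₂ y'| ≤ E (lam y₂) y')
    (h267 : ∀ (μ : g.Loc) (y y' : g.Site), g.suppIn μ y' →
      E μ y ≤ C * B6.pref4 (g.len y) n * Real.exp (-(r * g.dist y y')) * g.supNorm μ)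
    (hlen : ∀ y, 0 ≤ g.len y) (hsymm : ∀ a b : g.Site, g.dist a b = g.dist b a) :
    ∀ y₂ y', |K₃ y₂ y'| ≤ C * cQ * g.len y' ^ (1 : ℝ) * Real.exp (-(r * g.dist y₂ y')) := by
  intro y₂ y'
  have h := kerBound_of_entry E (fun a b => K₃ b a) lam n hn hC hsupp hnorm (fun a b => hval b a) h267 hlen y' y₂
  rw [hsymm y' y₂] at h
  exact h

end Dictionary

/-! ## §2  The first inequality of (2.88): the three kernel bounds from the printed Propositions 2.2 and 2.3 -/

section FirstInequality

/-- **THE THREE KERNEL BOUNDS OF (2.88) FROM THE VERBATIM PROPOSITIONS 2.2 AND 2.3.**  p. 238: *"We have from Lemma 2.1,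
Proposition 2.2 and (2.87), |(∂P∂*)_{μν}(x, x′)| = |(∂_μG′Q′*(Q′G′²Q′*)⁻¹Q′G′∂*_ν)(x, x′)| ≤ O(1) Σ_{y₁,y₂∈𝔅} L^jη
e^{−½δ₀d(y,y₁)}(L^{j₁}η)^{−4}e^{−½δ₁d(y₁,y₂)}(L^{j₂}η)^{−d} · e^{−½δ₀d(y₂,y′)}L^{j′}η"*.  From `B6.Prop22Printed geo Gp`
(witnesses M₁, δ₀, C′) and `B6.Prop23Printed d geo Cinv` (witnesses M₁′, δ₁, C″): with M₂ = max(M₁, M₁′), for every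
situation i under (2.1)–(2.2) with M_i ≥ M₂, 1 ≤ L, 0 < η, d symmetric, and every pair of outer kernels K₁, K₃ read
through entries n₁, n₃ ∈ {1, 2} of (2.67) (families λ₁, λ₃ with `hsupp`, `hnorm` ≤ c_Q, `hval`), the hypotheses of
`B6Cor28.ineq288_kernel` hold: |K₁(y, y₁)| ≤ C′c_Q(L^jη)e^{−½δ₀d(y,y₁)}, |(Q′G′²Q′*)⁻¹(y₁, y₂)| ≤
C″(L^{j₁}η)^{−4}(L^{j₂}η)^{−d}e^{−½δ₁d(y₁,y₂)} ((2.87) itself), |K₃(y₂, y′)| ≤ C′c_Q(L^{j′}η)e^{−½δ₀d(y₂,y′)}.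
[cite: Balaban1984PropagatorsII, (2.88) p.238; Prop. 2.2 (2.67) p.234; Prop. 2.3 (2.87) p.238] -/
theorem kernelBounds_of_printed {I : Type} (d : ℕ) (geo : I → B6.Geometry) (Gp : ∀ i, B6.GpFamily (geo i))
    (Cinv : ∀ i, B6.SiteKernel (geo i)) (h22 : B6.Prop22Printed geo Gp) (h23 : B6.Prop23Printed d geo Cinv) :
    ∃ M₂ δ₀ δ₁ C' C'' : ℝ, 0 < M₂ ∧ 0 < δ₀ ∧ 0 < δ₁ ∧ 0 < C' ∧ 0 < C'' ∧
      ∀ i, (geo i).Hyp21_22 → M₂ ≤ (geo i).M → 1 ≤ (geo i).L → 0 < (geo i).eta →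
        (∀ a b : (geo i).Site, (geo i).dist a b = (geo i).dist b a) →
        ∀ (n₁ n₃ : Fin 4), (∀ t, B6.pref4 t n₁ = t) → (∀ t, B6.pref4 t n₃ = t) →
        ∀ (K₁ K₃ : (geo i).Site → (geo i).Site → ℝ) (lam₁ lam₃ : (geo i).Site → (geo i).Loc) (cQ : ℝ),
          (∀ y₁, (geo i).suppIn (lam₁ y₁) y₁) → (∀ y₁, (geo i).supNorm (lam₁ y₁) ≤ cQ) →
          (∀ y₂, (geo i).suppIn (lam₃ y₂) y₂) → (∀ y₂, (geo i).supNorm (lam₃ y₂) ≤ cQ) →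
          (∀ y y₁, |K₁ y y₁| ≤ (Gp i).e n₁ (lam₁ y₁) y) →
          (∀ y₂ y', |K₃ y₂ y'| ≤ (Gp i).e n₃ (lam₃ y₂) y') →
          (∀ y y₁, |K₁ y y₁| ≤
              C' * cQ * (geo i).len y ^ (1 : ℝ) * Real.exp (-(δ₀ / 2 * (geo i).dist y y₁))) ∧
          (∀ y₁ y₂, |(Cinv i).ker y₁ y₂| ≤ C'' * (geo i).len y₁ ^ (-(4 : ℝ)) * (geo i).len y₂ ^ (-(d : ℝ)) *
              Real.exp (-(δ₁ / 2 * (geo i).dist y₁ y₂))) ∧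
          (∀ y₂ y', |K₃ y₂ y'| ≤
              C' * cQ * (geo i).len y' ^ (1 : ℝ) * Real.exp (-(δ₀ / 2 * (geo i).dist y₂ y'))) := by
  obtain ⟨M₁, δ₀, C', Cα, hM₁, hδ₀, hC', hall⟩ := h22
  obtain ⟨M₁', δ₁, C'', hM₁', hδ₁, hC'', hall'⟩ := h23
  refine ⟨max M₁ M₁', δ₀, δ₁, C', C'', lt_max_of_lt_left hM₁, hδ₀, hδ₁, hC', hC'', ?_⟩
  intro i hH hM hL hη hsymm n₁ n₃ hn₁ hn₃ K₁ K₃ lam₁ lam₃ cQ hsupp₁ hnorm₁ hsupp₃ hnorm₃ hval₁ hval₃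
  have hMi : M₁ ≤ (geo i).M := le_trans (le_max_left _ _) hM
  have hMi' : M₁' ≤ (geo i).M := le_trans (le_max_right _ _) hM
  have hlen : ∀ y, 0 ≤ (geo i).len y := fun y => (len_pos (geo i) hL hη y).le
  have h267 : ∀ (n : Fin 4) (μ : (geo i).Loc) (y y' : (geo i).Site), (geo i).suppIn μ y' →
      (Gp i).e n μ y ≤ C' * B6.pref4 ((geo i).len y) n * Real.exp (-(δ₀ / 2 * (geo i).dist y y')) *
        (geo i).supNorm μ := fun n μ y y' hs => (hall i hH hMi).1 n μ y y' hs
  exact ⟨kerBound_of_entry ((Gp i).e n₁) K₁ lam₁ n₁ hn₁ hC'.le hsupp₁ hnorm₁ hval₁ (h267 n₁) hlen,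
    fun y₁ y₂ => hall' i hH hMi' y₁ y₂,
    kerBound_of_entry_adj ((Gp i).e n₃) K₃ lam₃ n₃ hn₃ hC'.le hsupp₃ hnorm₃ hval₃ (h267 n₃) hlen hsymm⟩

end FirstInequality

/-! ## §3  The edge: Prop. 2.2 ∧ Prop. 2.3 ∧ Lemma 2.1 ⟹ (2.88) -/

section Edge

/-- (2.63) with a GENERIC constant c_L (`B6Lemma21Repaired.Ineq263With`), n = 3 factors, IS the three-point
convolution hypothesis `B6Cor28.Conv3` with C_c = c_L³, θ = (1 − α)δ. [cite: Balaban1984PropagatorsII, Lemma 2.1 (2.63) p.234] -/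
theorem conv3_of_ineq263With {cL : ℝ} (g : B6.Geometry) {δ α : ℝ} (h : Ineq263With cL g δ α) :
    Conv3 g.dist δ (cL ^ 3) ((1 - α) * δ) := by
  intro y y'
  have h2 := h 2 y y'
  simpa [B6RandomWalk.chain] using h2

/-- **(2.88) FROM GENERIC-CONSTANT (2.60)–(2.61)** — `B6Cor28.ineq288_of_lemma21` re-run with the Lemma-2.1 input of
ONE geometry in the generic-constant form ((2.60) `B6RandomWalk.Ineq260 g δ α`, (2.61) `Ineq261With c_L g δ α` at a
rate δ ≥ 0 and fraction 0 < α < 1; (2.63) follows by `ineq263With_of_261With` with (2.54)) instead of the tree's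
`B6.Lemma21Printed` (printed c₁(α), refuted as typed for d ≥ 3): three kernels bounded as in the first inequality of
(2.88) with rates a, b, c satisfying (1 + 2α)δ ≤ a, (1 + α)δ ≤ b, (1 + 2α)δ ≤ c, under 1 ≤ L, 0 < η, d ≥ 0 and the
largeness L⁴, L^d, L ≤ e^{αδRM}, compose to `Ineq288` with δ₂ = (1 − α)δ and O(1) = C₁C₂C₃·L⁴·L^d·L·c_L³.
[cite: Balaban1984PropagatorsII, (2.88) p.238; Lemma 2.1 (2.60)–(2.63) p.234] -/
theorem ineq288_generic (d : ℕ) (g : B6.Geometry) (htri : Triangle254 g) (δ α cL : ℝ) (hδ : 0 ≤ δ)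
    (hα0 : 0 < α) (hα1 : α < 1) (hL : 1 ≤ g.L) (hη : 0 < g.eta)
    (h260 : Ineq260 g δ α) (h261 : Ineq261With cL g δ α)
    (hl4 : g.L ^ (4 : ℝ) ≤ Real.exp (α * δ * g.R * g.M))
    (hld : g.L ^ (d : ℝ) ≤ Real.exp (α * δ * g.R * g.M))
    (hl1 : g.L ^ (1 : ℝ) ≤ Real.exp (α * δ * g.R * g.M))
    (hdist : ∀ y y', 0 ≤ g.dist y y')
    (K₁ K₂ K₃ : g.Site → g.Site → ℝ) (C₁ C₂ C₃ a b c : ℝ) (hC₁ : 0 ≤ C₁) (hC₂ : 0 ≤ C₂) (hC₃ : 0 ≤ C₃)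
    (ha : δ + 2 * (α * δ) ≤ a) (hb : δ + α * δ ≤ b) (hc : δ + 2 * (α * δ) ≤ c)
    (hK₁ : ∀ y y₁, |K₁ y y₁| ≤ C₁ * g.len y ^ (1 : ℝ) * Real.exp (-(a * g.dist y y₁)))
    (hK₂ : ∀ y₁ y₂, |K₂ y₁ y₂| ≤ C₂ * g.len y₁ ^ (-(4 : ℝ)) * g.len y₂ ^ (-(d : ℝ)) *
      Real.exp (-(b * g.dist y₁ y₂)))
    (hK₃ : ∀ y₂ y', |K₃ y₂ y'| ≤ C₃ * g.len y' ^ (1 : ℝ) * Real.exp (-(c * g.dist y₂ y'))) :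
    Ineq288 g d K₁ K₂ K₃ (C₁ * C₂ * C₃ * g.L ^ (4 : ℝ) * g.L ^ (d : ℝ) * g.L ^ (1 : ℝ) * cL ^ 3)
      ((1 - α) * δ) := by
  intro y y'
  have h263 := ineq263With_of_261With htri hδ hα1.le h261
  have hconv := conv3_of_ineq263With g h263
  have hL0 : 0 ≤ g.L := le_trans zero_le_one hL
  have e4 : |(-(4 : ℝ))| = 4 := by norm_num
  have ed : |(-(d : ℝ))| = (d : ℝ) := by rw [abs_neg]; exact abs_of_nonneg (Nat.cast_nonneg d)
  have e1 : |(1 : ℝ)| = 1 := abs_one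
  have hT₄ := (transfer_of_260 g.scale g.dist g.L g.eta (α * δ) g.R g.M (-(4 : ℝ)) hL hη
    (by rw [e4]; exact hl4) h260).2
  have hTd := (transfer_of_260 g.scale g.dist g.L g.eta (α * δ) g.R g.M (-(d : ℝ)) hL hη
    (by rw [ed]; exact hld) h260).1
  have hT₁ := (transfer_of_260 g.scale g.dist g.L g.eta (α * δ) g.R g.M (1 : ℝ) hL hη
    (by rw [e1]; exact hl1) h260).2
  rw [e4] at hT₄
  rw [ed] at hTd
  rw [e1] at hT₁
  rw [← len_eq_rpow] at hT₄ hTd hT₁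
  have hε : 0 ≤ α * δ := mul_nonneg hα0.le hδ
  exact ineq288_kernel g.len g.dist d K₁ K₂ K₃ C₁ C₂ C₃ a b c (α * δ) δ (g.L ^ (4 : ℝ)) (g.L ^ (d : ℝ))
    (g.L ^ (1 : ℝ)) (cL ^ 3) ((1 - α) * δ) (len_pos g hL hη) hdist htri hC₁ hC₂ hC₃ (Real.rpow_nonneg hL0 _)
    (Real.rpow_nonneg hL0 _) (Real.rpow_nonneg hL0 _) hε ha hb hc hK₁ hK₂ hK₃ hT₄ hTd hT₁ hconv y y'

/-- **THE EDGE PROP. 2.2 ∧ PROP. 2.3 ∧ LEMMA 2.1 → (2.88)** (p. 238 *"We have from Lemma 2.1, Proposition 2.2 and (2.87),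
… ≤ O(1)(L^jη)^{−2}(L^{j′}η)^{−d}e^{−δ₂d(y,y′)}, (2.88) … and δ₂ is determined by δ₀, δ₁"*).  From the verbatim typings
`B6.Prop22Printed geo Gp`, `B6.Prop23Printed d geo Cinv` (witnesses M₂, δ₀, δ₁, C′, C″ as in `kernelBounds_of_printed`):
for every situation i with M_i ≥ M₂ obeying (2.54), d ≥ 0 symmetric, 1 ≤ L, 0 < η, every pair of outer kernels K₁, K₃
read through entries of (2.67) with prefactor L^jη (`hsupp`, `hnorm` ≤ c_Q, `hval`; c_Q ≥ 0), and every Lemma-2.1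
input of that geometry at a rate δ ≥ 0 and fraction 0 < α < 1 COMPATIBLE WITH THE PRINTED RATES — (1 + 2α)δ ≤ ½δ₀,
(1 + α)δ ≤ ½δ₁ — in the generic-constant form (2.60) `Ineq260`, (2.61) `Ineq261With c_L`, with the largeness L⁴, L^d,
L ≤ e^{αδRM}: the kernels (K₁, (Q′G′²Q′*)⁻¹, K₃) satisfy `B6Cor28.Ineq288` with δ₂ = (1 − α)δ and O(1) =
(C′c_Q)·C″·(C′c_Q)·L⁴·L^d·L·c_L³. [cite: Balaban1984PropagatorsII, (2.88) p.238; Prop. 2.2 p.234; Prop. 2.3 p.238; Lemma 2.1 p.234] -/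
theorem ineq288_of_printed {I : Type} (d : ℕ) (geo : I → B6.Geometry) (Gp : ∀ i, B6.GpFamily (geo i))
    (Cinv : ∀ i, B6.SiteKernel (geo i)) (h22 : B6.Prop22Printed geo Gp) (h23 : B6.Prop23Printed d geo Cinv) :
    ∃ M₂ δ₀ δ₁ C' C'' : ℝ, 0 < M₂ ∧ 0 < δ₀ ∧ 0 < δ₁ ∧ 0 < C' ∧ 0 < C'' ∧
      ∀ i, (geo i).Hyp21_22 → M₂ ≤ (geo i).M → Triangle254 (geo i) → (∀ y y', 0 ≤ (geo i).dist y y') →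
        (∀ a b : (geo i).Site, (geo i).dist a b = (geo i).dist b a) → 1 ≤ (geo i).L → 0 < (geo i).eta →
        ∀ (n₁ n₃ : Fin 4), (∀ t, B6.pref4 t n₁ = t) → (∀ t, B6.pref4 t n₃ = t) →
        ∀ (K₁ K₃ : (geo i).Site → (geo i).Site → ℝ) (lam₁ lam₃ : (geo i).Site → (geo i).Loc) (cQ : ℝ),
          0 ≤ cQ →
          (∀ y₁, (geo i).suppIn (lam₁ y₁) y₁) → (∀ y₁, (geo i).supNorm (lam₁ y₁) ≤ cQ) →
          (∀ y₂, (geo i).suppIn (lam₃ y₂) y₂) → (∀ y₂, (geo i).supNorm (lam₃ y₂) ≤ cQ) →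
          (∀ y y₁, |K₁ y y₁| ≤ (Gp i).e n₁ (lam₁ y₁) y) →
          (∀ y₂ y', |K₃ y₂ y'| ≤ (Gp i).e n₃ (lam₃ y₂) y') →
        ∀ (δ α cL : ℝ), 0 ≤ δ → 0 < α → α < 1 →
          δ + 2 * (α * δ) ≤ δ₀ / 2 → δ + α * δ ≤ δ₁ / 2 →
          Ineq260 (geo i) δ α → Ineq261With cL (geo i) δ α →
          (geo i).L ^ (4 : ℝ) ≤ Real.exp (α * δ * (geo i).R * (geo i).M) →
          (geo i).L ^ (d : ℝ) ≤ Real.exp (α * δ * (geo i).R * (geo i).M) →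
          (geo i).L ^ (1 : ℝ) ≤ Real.exp (α * δ * (geo i).R * (geo i).M) →
          Ineq288 (geo i) d K₁ (Cinv i).ker K₃
            (C' * cQ * C'' * (C' * cQ) * (geo i).L ^ (4 : ℝ) * (geo i).L ^ (d : ℝ) * (geo i).L ^ (1 : ℝ) *
              cL ^ 3) ((1 - α) * δ) := by
  obtain ⟨M₂, δ₀, δ₁, C', C'', hM₂, hδ₀, hδ₁, hC', hC'', hall⟩ := kernelBounds_of_printed d geo Gp Cinv h22 h23
  refine ⟨M₂, δ₀, δ₁, C', C'', hM₂, hδ₀, hδ₁, hC', hC'', ?_⟩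
  intro i hH hM htri hdist hsymm hL hη n₁ n₃ hn₁ hn₃ K₁ K₃ lam₁ lam₃ cQ hcQ hsupp₁ hnorm₁ hsupp₃ hnorm₃ hval₁ hval₃
    δ α cL hδ hα0 hα1 ha hb h260 h261 hl4 hld hl1
  obtain ⟨hK₁, hK₂, hK₃⟩ :=
    hall i hH hM hL hη hsymm n₁ n₃ hn₁ hn₃ K₁ K₃ lam₁ lam₃ cQ hsupp₁ hnorm₁ hsupp₃ hnorm₃ hval₁ hval₃
  have hC₁ : 0 ≤ C' * cQ := mul_nonneg hC'.le hcQ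
  exact ineq288_generic d (geo i) htri δ α cL hδ hα0 hα1 hL hη h260 h261 hl4 hld hl1 hdist K₁ (Cinv i).ker K₃
    (C' * cQ) C'' (C' * cQ) (δ₀ / 2) (δ₁ / 2) (δ₀ / 2) hC₁ hC''.le hC₁ ha hb ha hK₁ hK₂ hK₃

/-- **THE SAME SENTENCE WITH THE TREE'S VERBATIM LEMMA 2.1** (`B6.Lemma21Printed d δ geo` at a rate δ: (2.60) ∧ (2.61)
with the printed c₁(α) under 0 < α < 1 and (2.59)) — literally *"from Lemma 2.1, Proposition 2.2 and (2.87)"* as typed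
Props, through pv01's `B6Cor28.ineq288_printed_of_lemma21`: O(1) = (C′c_Q)·C″·(C′c_Q)·L⁴·L^d·L·c₁(α)³, δ₂ = (1 − α)δ.
HONEST SCOPE: the antecedent `B6.Lemma21Printed` is refuted AS TYPED on geometries with d ≥ 3 (GAPS G-A11-1,
`B6Lemma21Counterexample`); the substantive edge is `ineq288_of_printed` (generic constant).
[cite: Balaban1984PropagatorsII, (2.88) p.238; Lemma 2.1 p.234; Prop. 2.2 p.234; Prop. 2.3 p.238] -/
theorem ineq288_of_printed_lemma21 {I : Type} (d : ℕ) (δ : ℝ) (hδ : 0 ≤ δ) (geo : I → B6.Geometry)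
    (Gp : ∀ i, B6.GpFamily (geo i)) (Cinv : ∀ i, B6.SiteKernel (geo i)) (h21 : B6.Lemma21Printed d δ geo)
    (h22 : B6.Prop22Printed geo Gp) (h23 : B6.Prop23Printed d geo Cinv) :
    ∃ M₂ δ₀ δ₁ C' C'' : ℝ, 0 < M₂ ∧ 0 < δ₀ ∧ 0 < δ₁ ∧ 0 < C' ∧ 0 < C'' ∧
      ∀ i, (geo i).Hyp21_22 → M₂ ≤ (geo i).M → Triangle254 (geo i) → (∀ y y', 0 ≤ (geo i).dist y y') →
        (∀ a b : (geo i).Site, (geo i).dist a b = (geo i).dist b a) → 1 ≤ (geo i).L → 0 < (geo i).eta →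
        ∀ (n₁ n₃ : Fin 4), (∀ t, B6.pref4 t n₁ = t) → (∀ t, B6.pref4 t n₃ = t) →
        ∀ (K₁ K₃ : (geo i).Site → (geo i).Site → ℝ) (lam₁ lam₃ : (geo i).Site → (geo i).Loc) (cQ : ℝ),
          0 ≤ cQ →
          (∀ y₁, (geo i).suppIn (lam₁ y₁) y₁) → (∀ y₁, (geo i).supNorm (lam₁ y₁) ≤ cQ) →
          (∀ y₂, (geo i).suppIn (lam₃ y₂) y₂) → (∀ y₂, (geo i).supNorm (lam₃ y₂) ≤ cQ) →
          (∀ y y₁, |K₁ y y₁| ≤ (Gp i).e n₁ (lam₁ y₁) y) →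
          (∀ y₂ y', |K₃ y₂ y'| ≤ (Gp i).e n₃ (lam₃ y₂) y') →
        ∀ α : ℝ, 0 < α → α < 1 → B6.Cond259 d δ α (geo i).R (geo i).M →
          δ + 2 * (α * δ) ≤ δ₀ / 2 → δ + α * δ ≤ δ₁ / 2 →
          (geo i).L ^ (4 : ℝ) ≤ Real.exp (α * δ * (geo i).R * (geo i).M) →
          (geo i).L ^ (d : ℝ) ≤ Real.exp (α * δ * (geo i).R * (geo i).M) →
          (geo i).L ^ (1 : ℝ) ≤ Real.exp (α * δ * (geo i).R * (geo i).M) →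
          Ineq288 (geo i) d K₁ (Cinv i).ker K₃
            (C' * cQ * C'' * (C' * cQ) * (geo i).L ^ (4 : ℝ) * (geo i).L ^ (d : ℝ) * (geo i).L ^ (1 : ℝ) *
              B6.c1 d δ α ^ 3) ((1 - α) * δ) := by
  obtain ⟨M₂, δ₀, δ₁, C', C'', hM₂, hδ₀, hδ₁, hC', hC'', hall⟩ := kernelBounds_of_printed d geo Gp Cinv h22 h23
  refine ⟨M₂, δ₀, δ₁, C', C'', hM₂, hδ₀, hδ₁, hC', hC'', ?_⟩
  intro i hH hM htri hdist hsymm hL hη n₁ n₃ hn₁ hn₃ K₁ K₃ lam₁ lam₃ cQ hcQ hsupp₁ hnorm₁ hsupp₃ hnorm₃ hval₁ hval₃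
    α hα0 hα1 h259 ha hb hl4 hld hl1
  obtain ⟨hK₁, hK₂, hK₃⟩ :=
    hall i hH hM hL hη hsymm n₁ n₃ hn₁ hn₃ K₁ K₃ lam₁ lam₃ cQ hsupp₁ hnorm₁ hsupp₃ hnorm₃ hval₁ hval₃
  have hC₁ : 0 ≤ C' * cQ := mul_nonneg hC'.le hcQ
  exact ineq288_printed_of_lemma21 d δ hδ geo h21 i htri hH α hα0 hα1 h259 hL hη hl4 hld hl1 hdist K₁ (Cinv i).ker
    K₃ (C' * cQ) C'' (C' * cQ) (δ₀ / 2) (δ₁ / 2) (δ₀ / 2) hC₁ hC''.le hC₁ ha hb ha hK₁ hK₂ hK₃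

/-- **THE SAME SENTENCE WITH THE REPAIRED LEMMA 2.1′ OF THE TREE** (v1.1, seat r03 gen 8): *"from Lemma 2.1,
Proposition 2.2 and (2.87)"* as typed Props, the Lemma-2.1 antecedent being `B6Lemma21Repaired.Lemma21Repaired d δ geo`
((2.60) ∧ (2.61) with the repaired constant c₁′ = `B6Lemma21Arith.c1Repaired d δ α` = 13c₀(½α)^{3d}, PROVED
unconditionally on the multi-level tower family — `B6TowerSums`, row B6.Lem2.1) instead of the verbatim
`B6.Lemma21Printed` (refuted AS TYPED for d ≥ 2 on multi-level geometries; `ineq288_of_printed_lemma21` above keeps the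
printed antecedent for the record only): O(1) = (C′c_Q)·C″·(C′c_Q)·L⁴·L^d·L·c₁′³, δ₂ = (1 − α)δ.  One line from
`ineq288_of_printed` (generic constant c_L ↦ c₁′).
[cite: Balaban1984PropagatorsII, (2.88) p.238; Lemma 2.1 p.234; Prop. 2.2 p.234; Prop. 2.3 p.238; repaired] -/
theorem ineq288_of_printed_lemma21Repaired {I : Type} (d : ℕ) (δ : ℝ) (hδ : 0 ≤ δ) (geo : I → B6.Geometry)
    (Gp : ∀ i, B6.GpFamily (geo i)) (Cinv : ∀ i, B6.SiteKernel (geo i))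
    (h21 : B6Lemma21Repaired.Lemma21Repaired d δ geo)
    (h22 : B6.Prop22Printed geo Gp) (h23 : B6.Prop23Printed d geo Cinv) :
    ∃ M₂ δ₀ δ₁ C' C'' : ℝ, 0 < M₂ ∧ 0 < δ₀ ∧ 0 < δ₁ ∧ 0 < C' ∧ 0 < C'' ∧
      ∀ i, (geo i).Hyp21_22 → M₂ ≤ (geo i).M → Triangle254 (geo i) → (∀ y y', 0 ≤ (geo i).dist y y') →
        (∀ a b : (geo i).Site, (geo i).dist a b = (geo i).dist b a) → 1 ≤ (geo i).L → 0 < (geo i).eta →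
        ∀ (n₁ n₃ : Fin 4), (∀ t, B6.pref4 t n₁ = t) → (∀ t, B6.pref4 t n₃ = t) →
        ∀ (K₁ K₃ : (geo i).Site → (geo i).Site → ℝ) (lam₁ lam₃ : (geo i).Site → (geo i).Loc) (cQ : ℝ),
          0 ≤ cQ →
          (∀ y₁, (geo i).suppIn (lam₁ y₁) y₁) → (∀ y₁, (geo i).supNorm (lam₁ y₁) ≤ cQ) →
          (∀ y₂, (geo i).suppIn (lam₃ y₂) y₂) → (∀ y₂, (geo i).supNorm (lam₃ y₂) ≤ cQ) →
          (∀ y y₁, |K₁ y y₁| ≤ (Gp i).e n₁ (lam₁ y₁) y) →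
          (∀ y₂ y', |K₃ y₂ y'| ≤ (Gp i).e n₃ (lam₃ y₂) y') →
        ∀ α : ℝ, 0 < α → α < 1 → B6.Cond259 d δ α (geo i).R (geo i).M →
          δ + 2 * (α * δ) ≤ δ₀ / 2 → δ + α * δ ≤ δ₁ / 2 →
          (geo i).L ^ (4 : ℝ) ≤ Real.exp (α * δ * (geo i).R * (geo i).M) →
          (geo i).L ^ (d : ℝ) ≤ Real.exp (α * δ * (geo i).R * (geo i).M) →
          (geo i).L ^ (1 : ℝ) ≤ Real.exp (α * δ * (geo i).R * (geo i).M) →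
          Ineq288 (geo i) d K₁ (Cinv i).ker K₃
            (C' * cQ * C'' * (C' * cQ) * (geo i).L ^ (4 : ℝ) * (geo i).L ^ (d : ℝ) * (geo i).L ^ (1 : ℝ) *
              B6Lemma21Arith.c1Repaired d δ α ^ 3) ((1 - α) * δ) := by
  obtain ⟨M₂, δ₀, δ₁, C', C'', hM₂, hδ₀, hδ₁, hC', hC'', hall⟩ := ineq288_of_printed d geo Gp Cinv h22 h23
  refine ⟨M₂, δ₀, δ₁, C', C'', hM₂, hδ₀, hδ₁, hC', hC'', ?_⟩
  intro i hH hM htri hdist hsymm hL hη n₁ n₃ hn₁ hn₃ K₁ K₃ lam₁ lam₃ cQ hcQ hsupp₁ hnorm₁ hsupp₃ hnorm₃ hval₁ hval₃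
    α hα0 hα1 h259 ha hb hl4 hld hl1
  obtain ⟨h260, h261⟩ := h21 i hH α hα0 hα1 h259
  exact hall i hH hM htri hdist hsymm hL hη n₁ n₃ hn₁ hn₃ K₁ K₃ lam₁ lam₃ cQ hcQ hsupp₁ hnorm₁ hsupp₃ hnorm₃ hval₁
    hval₃ δ α _ hδ hα0 hα1 ha hb h260 h261 hl4 hld hl1

end Edge

/-! ## §4  Consistency: the hypothesis package of `ineq288_of_printed` on the one-site family -/

section NonVacuity

/-- The ONE-SITE FAMILY (indexed by the block size M): one site at scale 0, d ≡ 0, L = η = R = 1, (2.1)–(2.2) vacuous,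
`Loc` = the functions on the site with `suppIn` ≡ True and `supNorm λ` = |λ(·)|, inert Hölder ∕ cut-off fields.
A model for the consistency check only. [folklore] -/
def unitGeo (M : ℝ) : B6.Geometry where
  Site := Unit
  fin := inferInstance
  scale := fun _ => 0
  dist := fun _ _ => 0
  k := 0
  eta := 1
  L := 1
  R := 1
  M := M
  Hyp21_22 := True
  Loc := Unit → ℝ
  suppIn := fun _ _ => True
  supNorm := fun μ => |μ ()|
  l2Norm := fun _ => 0
  holder := fun _ _ => 0
  Cut := Unit
  cutIn := fun _ _ => True
  cutH := fun _ _ => 0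
  cutSup := fun _ => 0

/-- The (2.67)-family of the model: every entry e_n(λ, y) = |λ(·)|, Hölder entries 0. [folklore] -/
def unitGp (M : ℝ) : B6.GpFamily (unitGeo M) where
  e := fun _ μ _ => |μ ()|
  h1 := fun _ _ _ => 0

/-- The (2.87)-kernel of the model: ≡ 1. [folklore] -/
def unitKer (M : ℝ) : B6.SiteKernel (unitGeo M) where
  ker := fun _ _ => 1

/-- L^jη = 1 on the model. [folklore] -/
@[simp] theorem unitGeo_len (M : ℝ) (y : (unitGeo M).Site) : (unitGeo M).len y = 1 := by
  simp [B6.Geometry.len, unitGeo]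

/-- d ≡ 0 on the model. [folklore] -/
@[simp] theorem unitGeo_dist (M : ℝ) (a b : (unitGeo M).Site) : (unitGeo M).dist a b = 0 := rfl

/-- `B6.Prop22Printed` IS INHABITED on the one-site family: M₁ = δ₀ = C = 1, C_α ≡ 0 (every prefactor of the table
is 1 at L^jη = 1). [folklore] -/
theorem prop22Printed_unit : B6.Prop22Printed (fun M : ℝ => unitGeo M) (fun M => unitGp M) := by
  refine ⟨1, 1, 1, fun _ => 0, one_pos, one_pos, one_pos, fun M _ _ => ⟨?_, ?_⟩⟩
  · intro n lam y y' _
    have hpref : B6.pref4 ((unitGeo M).len y) n = 1 := by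
      rw [unitGeo_len]; fin_cases n <;> simp [B6.pref4]
    rw [hpref, unitGeo_dist]
    show |lam ()| ≤ 1 * 1 * Real.exp (-(1 / 2 * 0)) * |lam ()|
    simp
  · intro α lam ζ y y' _ _ _ _
    show (0 : ℝ) ≤ 0 * (unitGeo M).len y ^ (1 - α) * 0 * Real.exp (-(1 / 2 * (unitGeo M).dist y y')) * |lam ()|
    simp

/-- `B6.Prop23Printed` IS INHABITED on the one-site family: M₁ = δ₁ = C = 1. [folklore] -/
theorem prop23Printed_unit (d : ℕ) : B6.Prop23Printed d (fun M : ℝ => unitGeo M) (fun M => unitKer M) := by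
  refine ⟨1, 1, 1, one_pos, one_pos, one_pos, fun M _ _ y y' => ?_⟩
  show |(1 : ℝ)| ≤ 1 * (unitGeo M).len y ^ (-(4 : ℝ)) * (unitGeo M).len y' ^ (-(d : ℝ)) *
    Real.exp (-(1 / 2 * (unitGeo M).dist y y'))
  simp

/-- **NON-VACUITY OF `ineq288_of_printed`**: on the one-site family both printed Props are inhabited
(`prop22Printed_unit`, `prop23Printed_unit`) and — the `obtain`∕`exact` lines below are the edge theorem applied at the
member M := M₂ with EVERY hypothesis discharged ((2.54), symmetry, 1 ≤ L, 0 < η, entries n₁ = n₃ = 1, kernels ≡ 1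
read through λ ≡ 1 with c_Q = 1, δ = 0, α = ½, c_L = 1, (2.60), (2.61), largeness) — it yields the (2.88)-shape bound
for the unit kernels with some explicit constant; so the hypothesis package is not contradictory. [folklore] -/
theorem unitGeo_nonvacuous (d : ℕ) :
    ∃ (M C δ₂ : ℝ), Ineq288 (unitGeo M) d (fun _ _ => 1) (fun _ _ => 1) (fun _ _ => 1) C δ₂ := by
  obtain ⟨M₂, δ₀, δ₁, C', C'', hM₂, hδ₀, hδ₁, hC', hC'', hall⟩ :=
    ineq288_of_printed d (fun M : ℝ => unitGeo M) (fun M => unitGp M) (fun M => unitKer M) prop22Printed_unit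
      (prop23Printed_unit d)
  refine ⟨M₂, _, _, hall M₂ trivial le_rfl (fun _ _ _ => by simp) (fun _ _ => le_rfl) (fun _ _ => rfl) le_rfl
    one_pos 1 1 pref4_one pref4_one (fun _ _ => 1) (fun _ _ => 1) (fun _ => fun _ => 1) (fun _ => fun _ => 1) 1
    zero_le_one (fun _ => trivial) (fun _ => by simp [unitGeo]) (fun _ => trivial) (fun _ => by simp [unitGeo])
    (fun _ _ => by simp [unitGp]) (fun _ _ => by simp [unitGp]) 0 (1 / 2) 1 le_rfl (by norm_num) (by norm_num)
    (by simp; positivity) (by simp; positivity) (fun _ _ => by simp) (fun _ => by simp [unitGeo]) ?_ ?_ ?_⟩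
  · show (1 : ℝ) ^ (4 : ℝ) ≤ Real.exp (1 / 2 * 0 * 1 * M₂); simp
  · show (1 : ℝ) ^ (d : ℝ) ≤ Real.exp (1 / 2 * 0 * 1 * M₂); simp
  · show (1 : ℝ) ^ (1 : ℝ) ≤ Real.exp (1 / 2 * 0 * 1 * M₂); simp

end NonVacuity

end Literature.MathematicalPhysics.QuantumFieldTheory.Balaban1983to89.B6Ineq288Edge
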